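import Literature.Computability.AlgebraicComplexity.VNPClosedUnderIteratedDerivatives
import Literature.Computability.AlgebraicComplexity.VNPClosedUnderComposition
import Literature.AlgebraicGeometry.Resolution.WeightedCentreCharPIntegration
import HarnessLib

/-!
# `VNP` is closed under integration (Bürgisser 2024 survey §3.1; Valiant 1982)

P. Bürgisser, *Completeness classes in algebraic complexity theory*, arXiv:2406.06217 (2024), §3.1
(p. 13 of the held text, lines 39–47): "Valiant also proved in [vali:82] that `VNP` is closed under
`p`-bounded applications of differentiation and integration.  Again, the classes `VF`, `VBP`, and
`VP` fail to be closed under these operations, as the following formula shows: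
`∂/∂y₁ ⋯ ∂/∂yₙ f_n = (3/2)ⁿ ∫_{-1}^{1} ⋯ ∫_{-1}^{1} y₁ ⋯ yₙ f_n dy₁ ⋯ dyₙ = PER_n`"
(for `f_n = ∏_i Σ_j x_{ij} y_j`).  The tree renders the differentiation half
(`VNPClosedUnderDifferentiation.lean`, `VNPClosedUnderIteratedDerivatives.lean`:
`IsVNPFamily.foldr_pderiv`; `PermanentAsCoefficient.lean`: `foldr_pderiv_prod_sum_X_mul_X_eq_perPoly`,
whose docstring records that the integral "is not rendered").  This file renders the INTEGRATION
half: the formal definite integral, the closure of `VNP` under iterated integration along arbitrary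
words of variables, and the displayed integral identity.

## Main definitions and statements

* `dintegral j a b f` — the formal definite integral `∫_a^b f dX_j` (`K`-linear, `X_j` integrated
  out; `c X^m ↦ c (b^{m_j+1} − a^{m_j+1})/(m_j+1) X^{m − m_j e_j}`); in characteristic `0` it is
  `F(X_j := b) − F(X_j := a)` for the tree's formal antiderivative `F = CharPIntegration.integrate j f`
  (`dintegral_eq_aeval_integrate_sub`).
* `IsVNPFamily.foldr_dintegral` — **`VNP` is closed under iterated integration** (char. `0`): for a
  `p`-definable `(f_n)`, every family of words `l_n` of variables and limits `a_n, b_n`, the family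
  `(l_n.foldr (fun j q => ∫_{a_{n,j}}^{b_{n,j}} q dX_j) f_n)_n` is `p`-definable — with NO bound on
  the word lengths (stronger than the printed "`p`-bounded applications"; a repeated letter only
  contributes a constant factor `b − a`).  `isVNPFamily_dintegral`: one integral per index.
* `Bur24_sec3_1_integral_prod_sum_X_mul_X_eq_perPoly` — the displayed identity
  `(3/2)ⁿ ∫_{-1}^{1} ⋯ ∫_{-1}^{1} y₁ ⋯ yₙ f_n dy₁ ⋯ dyₙ = PER_n` (any duplicate-free exhaustive word of
  `y`-variables; `…_finRange_…` for `ι = Fin n`), via the general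
  `foldr_dintegral_prod_X_mul_of_isWeightedHomogeneous`: for `p` homogeneous of degree `n` in the
  `y`-block, `∫_{[-1,1]ⁿ} y₁⋯yₙ p dy = (2/3)ⁿ [y₁⋯yₙ] p`, combined with the tree's
  `coeff_prod_sum_X_mul_X_eq_perPoly` (`[y₁⋯yₙ] f_n = PER_n`).
* §5, the survey's conclusion "the classes `VF`, `VBP`, and `VP` fail to be closed under these
  operations" (unless they contain `VNP`) for INTEGRATION, in the currency of
  `PermanentAsCoefficient.lean`'s derivative/coefficient versions:
  `isVPFamily_perPoly_of_dintegral_closed`, `isVPwsFamily_perPoly_of_dintegral_closed`,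
  `isPBounded_formulaComplexity_perPoly_of_dintegral_closed` (`(PER_n) ∈ VP`, resp. `VBP`, `VF`, if
  the class is closed under the integrations `∫_{-1}^{1} dy_j` — applied to the `VF` test family
  `((3/2)ⁿ y₁ ⋯ yₙ f_n)_n`, whose iterated integral is `PER_n`), and the contrapositives
  `IsVNPFamily.isVPFamily_of_dintegral_closed`, `IsVNPFamily.isVPwsFamily_of_dintegral_closed`,
  `IsVNPFamily.isPBounded_formulaComplexity_of_dintegral_closed` (`VNP`-completeness of `PER`,
  characteristic `0`).

## Proof of the closure (one-shot coefficient formula)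

Valiant's paper [vali:82] is not held; the argument here reduces integration to Prop. 3.1 (closure
under taking coefficients, `IsVNPFamily.coeff_sumAlgEquiv`) in one shot, as the tree does for
derivatives via the Taylor shift: move the letters of the word to an outer block of variables
(`X_i ↦ X_{inl i}` for letters, `X_i ↦ X_{inr i}` otherwise — a `VNP`-preserving substitution,
`IsVNPFamily.aeval`), multiply by the kernel
`∏_{j ∈ l} (b_j − a_j)^{#_l j − 1} Σ_{k ≤ d} (b_j^{k+1} − a_j^{k+1})/(k+1) · X_{inl j}^{d−k}` with
`d = deg f_n` (a `VP` family, `isVPFamily_integrationKernel`; products keep `VNP`,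
`IsVNPFamily.mul`), and read off the coefficient of `∏_{j∈l} X_{inl j}^d`
(`foldr_dintegral_eq_coeff`; on monomials `foldr_dintegral_monomial` and the kernel computation
`coeff_monomial_mul_kernel`, by induction on the block with a separation-of-variables lemma).

## References

* [Burgisser2024Completeness] P. Bürgisser, Completeness classes in algebraic complexity theory,
  arXiv:2406.06217, §3.1.
* [Valiant1982] L. G. Valiant, Reducibility by algebraic projections, L'Enseignement Math. 28
  (1982), §3 (cited through the survey; not held).
* [Matsumura1987] H. Matsumura, Commutative Ring Theory, §25 (formal antiderivatives; the tree's
  `CharPIntegration.integrate`).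
-/

noncomputable section

universe u v w

open MvPolynomial

namespace Literature.Computability.AlgebraicComplexity

/-! ## §1. The formal definite integral `∫_a^b f dX_j` -/

section Definite

variable {K : Type*} [Field K] {σ : Type*}

/-- **The formal definite integral** `∫_a^b f dX_j` of a polynomial `f ∈ K[X_σ]` with respect to
the variable `X_j` between the constant limits `a, b ∈ K`: the `K`-linear map with
`c · X^m ↦ c · (b^{m_j + 1} − a^{m_j + 1}) / (m_j + 1) · X^{m − m_j e_j}` (the variable `X_j` is
integrated out; the result is a polynomial in the remaining variables, read in `K[X_σ]`).  Over a
field of characteristic zero this is `F(X_j := b) − F(X_j := a)` for the formal antiderivative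
`F = ∫ f dX_j` of the tree (`CharPIntegration.integrate`, `dintegral_eq_aeval_integrate_sub`).  It is
the operation of Bürgisser's survey §3.1, "`VNP` is closed under `p`-bounded applications of
differentiation and integration" [vali:82], whose displayed instance is
`(3/2)ⁿ ∫_{-1}^{1} ⋯ ∫_{-1}^{1} y₁ ⋯ yₙ f_n dy₁ ⋯ dyₙ = PER_n`.
[cite: Burgisser2024Completeness, §3.1 (p0013 L39–L47)] [cite: Valiant1982, §3] -/
def dintegral (j : σ) (a b : K) (f : MvPolynomial σ K) : MvPolynomial σ K :=
  (AddMonoidAlgebra.coeff f).sum fun m c =>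
    monomial (m.erase j) (c * ((b ^ (m j + 1) - a ^ (m j + 1)) / ((m j : K) + 1)))

/-- `∫_a^b c X^m dX_j = c (b^{m_j+1} − a^{m_j+1})/(m_j+1) · X^{m − m_j e_j}`.
[cite: Burgisser2024Completeness, §3.1 (p0013 L39–L47)] -/
theorem dintegral_monomial (j : σ) (a b : K) (m : σ →₀ ℕ) (c : K) :
    dintegral j a b (monomial m c) =
      monomial (m.erase j) (c * ((b ^ (m j + 1) - a ^ (m j + 1)) / ((m j : K) + 1))) := by
  rw [dintegral]
  exact sum_monomial_eq (by rw [zero_mul, monomial_zero])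

/-- `∫_a^b 0 dX_j = 0`. [cite: Burgisser2024Completeness, §3.1 (p0013 L39–L47)] -/
@[simp] theorem dintegral_zero (j : σ) (a b : K) : dintegral j a b (0 : MvPolynomial σ K) = 0 :=
  Finsupp.sum_zero_index

/-- Additivity of `∫_a^b · dX_j`. [cite: Burgisser2024Completeness, §3.1 (p0013 L39–L47)] -/
theorem dintegral_add (j : σ) (a b : K) (f g : MvPolynomial σ K) :
    dintegral j a b (f + g) = dintegral j a b f + dintegral j a b g := by
  classical
  exact Finsupp.sum_add_index' (fun m => by rw [zero_mul, monomial_zero])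
    (fun m c₁ c₂ => by rw [add_mul, map_add])

/-- Homogeneity of `∫_a^b · dX_j`. [cite: Burgisser2024Completeness, §3.1 (p0013 L39–L47)] -/
theorem dintegral_smul (j : σ) (a b : K) (r : K) (f : MvPolynomial σ K) :
    dintegral j a b (r • f) = r • dintegral j a b f := by
  classical
  unfold dintegral
  rw [AddMonoidAlgebra.coeff_smul, Finsupp.sum_smul_index' (fun m => by rw [zero_mul, monomial_zero]),
    Finsupp.smul_sum]
  refine Finsupp.sum_congr fun m _ => ?_
  rw [smul_monomial, smul_eq_mul, smul_eq_mul, mul_assoc]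

/-- `∫_a^b (C r · f) dX_j = C r · ∫_a^b f dX_j`. [cite: Burgisser2024Completeness, §3.1 (p0013 L39–L47)] -/
theorem dintegral_C_mul (j : σ) (a b : K) (r : K) (f : MvPolynomial σ K) :
    dintegral j a b (C r * f) = C r * dintegral j a b f := by
  rw [C_mul', dintegral_smul, C_mul']

/-- `∫_a^b · dX_j` commutes with finite sums. [cite: Burgisser2024Completeness, §3.1 (p0013 L39–L47)] -/
theorem dintegral_sum {ι : Type*} (j : σ) (a b : K) (s : Finset ι) (f : ι → MvPolynomial σ K) :
    dintegral j a b (∑ i ∈ s, f i) = ∑ i ∈ s, dintegral j a b (f i) := by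
  classical
  induction s using Finset.induction_on with
  | empty => simp
  | insert i s hi ih => rw [Finset.sum_insert hi, Finset.sum_insert hi, dintegral_add, ih]

/-- Additivity of the tree's formal antiderivative `∫ · dX_j` (`CharPIntegration.integrate`).
[cite: Matsumura1987, §25 (pp. 190–192)] -/
theorem integrate_add (j : σ) (f g : MvPolynomial σ K) :
    AlgebraicGeometry.Resolution.WeightedBlowup.CharPIntegration.integrate j (f + g) =
      AlgebraicGeometry.Resolution.WeightedBlowup.CharPIntegration.integrate j f +
        AlgebraicGeometry.Resolution.WeightedBlowup.CharPIntegration.integrate j g := by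
  classical
  ext d
  rw [coeff_add]
  by_cases hd : d j = 0
  · simp only [AlgebraicGeometry.Resolution.WeightedBlowup.CharPIntegration.coeff_integrate_of_apply_eq_zero
      j _ hd, add_zero]
  · obtain ⟨m, rfl⟩ : ∃ m, d = m + Finsupp.single j 1 :=
      ⟨d - Finsupp.single j 1, (tsub_add_cancel_of_le
        (Finsupp.single_le_iff.2 (Nat.one_le_iff_ne_zero.2 hd))).symm⟩
    simp only [AlgebraicGeometry.Resolution.WeightedBlowup.CharPIntegration.coeff_integrate,
      coeff_add, add_div]

/-- The antiderivative of a monomial. [cite: Matsumura1987, §25 (pp. 190–192)] -/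
theorem integrate_monomial (j : σ) (m : σ →₀ ℕ) (c : K) :
    AlgebraicGeometry.Resolution.WeightedBlowup.CharPIntegration.integrate j (monomial m c) =
      monomial (m + Finsupp.single j 1) (c / ((m j : K) + 1)) := by
  classical
  ext d
  by_cases hd : d j = 0
  · rw [AlgebraicGeometry.Resolution.WeightedBlowup.CharPIntegration.coeff_integrate_of_apply_eq_zero
      j _ hd, coeff_monomial, if_neg]
    rintro rfl
    simp at hd
  · obtain ⟨d, rfl⟩ : ∃ m, d = m + Finsupp.single j 1 :=
      ⟨d - Finsupp.single j 1, (tsub_add_cancel_of_le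
        (Finsupp.single_le_iff.2 (Nat.one_le_iff_ne_zero.2 hd))).symm⟩
    rw [AlgebraicGeometry.Resolution.WeightedBlowup.CharPIntegration.coeff_integrate, coeff_monomial,
      coeff_monomial]
    by_cases hm : m = d
    · subst hm; rw [if_pos rfl, if_pos rfl]
    · rw [if_neg hm, if_neg (fun h => hm (add_right_cancel h)), zero_div]

/-- **Fundamental theorem of calculus, formal version**: in characteristic zero,
`∫_a^b f dX_j = F(X_j := b) − F(X_j := a)` for the formal antiderivative `F = ∫ f dX_j`
(`CharPIntegration.integrate`). [cite: Matsumura1987, §25 (pp. 190–192)] -/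
theorem dintegral_eq_aeval_integrate_sub [CharZero K] [DecidableEq σ] (j : σ) (a b : K)
    (f : MvPolynomial σ K) :
    dintegral j a b f =
      aeval (Function.update X j (C b))
          (AlgebraicGeometry.Resolution.WeightedBlowup.CharPIntegration.integrate j f) -
        aeval (Function.update X j (C a))
          (AlgebraicGeometry.Resolution.WeightedBlowup.CharPIntegration.integrate j f) := by
  -- evaluation of `X_j` at a constant on a monomial
  have key : ∀ (t : K) (m : σ →₀ ℕ) (c : K),
      aeval (Function.update X j (C t)) (monomial (m + Finsupp.single j 1) c) =
        monomial (m.erase j) (c * t ^ (m j + 1)) := by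
    intro t m c
    have hexp : m + Finsupp.single j 1 = Finsupp.single j (m j + 1) + m.erase j :=
      calc m + Finsupp.single j 1 = (Finsupp.single j (m j) + m.erase j) + Finsupp.single j 1 := by
            rw [Finsupp.single_add_erase]
        _ = _ := by rw [add_right_comm, ← Finsupp.single_add]
    have hsplit : monomial (m + Finsupp.single j 1) c =
        C c * X j ^ (m j + 1) * monomial (m.erase j) (1 : K) := by
      rw [hexp, X_pow_eq_monomial, C_mul_monomial, monomial_mul, mul_one, mul_one]
    have hfix : aeval (Function.update X j (C t)) (monomial (m.erase j) (1 : K)) =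
        monomial (m.erase j) 1 := by
      rw [monomial_eq, C_1, one_mul, map_finsuppProd]
      refine Finsupp.prod_congr fun i hi => ?_
      rw [map_pow, aeval_X, Function.update_of_ne]
      rintro rfl
      simp [Finsupp.support_erase] at hi
    rw [hsplit, map_mul, map_mul, aeval_C, map_pow, aeval_X, Function.update_self, hfix,
      algebraMap_eq, ← map_pow, ← map_mul, C_mul_monomial, mul_one]
  induction f using MvPolynomial.induction_on' with
  | monomial m c =>
    rw [dintegral_monomial, integrate_monomial, key, key, ← map_sub]
    congr 1
    rw [div_mul_eq_mul_div, div_mul_eq_mul_div, ← sub_div, ← mul_sub, mul_div_assoc]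
  | add p q hp hq =>
    rw [dintegral_add, integrate_add, map_add, map_add, hp, hq]
    abel

end Definite

/-! ## §2. Iterated integrals along words and the one-shot coefficient formula

For a word `l = [v₁, …, v_r]` of variables, `l.foldr (fun j q => ∫_{a_j}^{b_j} q dX_j) f` is the
iterated integral `∫ dX_{v₁} ∫ dX_{v₂} ⋯ ∫ f dX_{v_r}` (innermost = last letter).  On a monomial it
multiplies the coefficient by `∏_{j ∈ l} (b_j − a_j)^{#_l j − 1} · (b_j^{m_j+1} − a_j^{m_j+1})/(m_j+1)`
and deletes the variables of `l` (`foldr_dintegral_monomial`); globally it is ONE coefficient of the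
product of `f` (variables of `l` moved to an outer block) with a fixed kernel polynomial
(`foldr_dintegral_eq_coeff`) — the form in which Prop. 3.1 (closure of `VNP` under coefficients)
applies. -/

section KernelCoeff

variable {A : Type*} [CommSemiring A] {σ : Type*} [DecidableEq σ]

/-- Separation of variables for coefficients: if `P` involves only `X_{j₀}` and `Q` does not
involve `X_{j₀}`, the `X_{j₀}^d · X^D`-coefficient of `P Q` (`D` off `j₀`) factors. [folklore] -/
private theorem coeff_single_add_mul (j₀ : σ) (d : ℕ) (D : σ →₀ ℕ) (hD : D j₀ = 0)
    (P Q : MvPolynomial σ A) (hP : P.vars ⊆ {j₀}) (hQ : j₀ ∉ Q.vars) :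
    coeff (Finsupp.single j₀ d + D) (P * Q) = coeff (Finsupp.single j₀ d) P * coeff D Q := by
  classical
  -- every monomial of `Q` is free of `X_{j₀}`
  have hQ0 : ∀ w : σ →₀ ℕ, w j₀ ≠ 0 → coeff w Q = 0 := fun w hw => by
    by_contra h
    exact hQ ((mem_vars_iff_mem_support j₀).2 ⟨w, mem_support_iff.2 h, Finsupp.mem_support_iff.2 hw⟩)
  -- every monomial of `P` is a power of `X_{j₀}`
  have hPu : ∀ u ∈ P.support, u = Finsupp.single j₀ (u j₀) := fun u hu => by
    refine Finsupp.support_subset_singleton.1 fun i hi => ?_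
    exact hP ((mem_vars_iff_mem_support i).2 ⟨u, hu, hi⟩)
  have hsD : (Finsupp.single j₀ d + D) j₀ = d := by
    rw [Finsupp.add_apply, Finsupp.single_eq_same, hD, add_zero]
  conv_lhs => rw [P.as_sum, Finset.sum_mul, coeff_sum]
  rw [Finset.sum_congr rfl fun u hu => coeff_monomial_mul' _ _ _ _]
  -- all terms but `u = X_{j₀}^d` vanish
  have hvanish : ∀ u ∈ P.support, u ≠ Finsupp.single j₀ d →
      (if u ≤ Finsupp.single j₀ d + D then coeff u P * coeff (Finsupp.single j₀ d + D - u) Q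
        else 0) = 0 := by
    intro u hu hne
    have hu' := hPu u hu
    split_ifs with hle
    · rw [hQ0, mul_zero]
      rw [Finsupp.tsub_apply, hsD, hu']
      intro h
      apply hne
      rw [hu']
      congr 1
      have h1 : u j₀ ≤ d := by have := hle j₀; rwa [hsD] at this
      rw [Finsupp.single_eq_same] at h
      omega
    · rfl
  by_cases hs : Finsupp.single j₀ d ∈ P.support
  · rw [← Finset.add_sum_erase _ _ hs, if_pos le_self_add, add_tsub_cancel_left,
      Finset.sum_eq_zero fun u hu => hvanish u (Finset.mem_of_mem_erase hu) (Finset.ne_of_mem_erase hu),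
      add_zero]
  · rw [notMem_support_iff.1 hs, zero_mul]
    exact Finset.sum_eq_zero fun u hu => hvanish u hu fun h => hs (h ▸ hu)

/-- The one-variable kernel: the `X_j^d`-coefficient of `X_j^e · Σ_{k ≤ d} t_k X_j^{d−k}` is `t_e`
(`e ≤ d`). [folklore] -/
private theorem coeff_X_pow_mul_kernel (j : σ) {d e : ℕ} (he : e ≤ d) (t : ℕ → A) :
    coeff (Finsupp.single j d)
        (X j ^ e * ∑ k ∈ Finset.range (d + 1), C (t k) * X j ^ (d - k)) = t e := by
  rw [Finset.mul_sum, coeff_sum]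
  have hterm : ∀ k, (X j ^ e * (C (t k) * X j ^ (d - k)) : MvPolynomial σ A) =
      monomial (Finsupp.single j (e + (d - k))) (t k) := fun k => by
    rw [X_pow_eq_monomial, X_pow_eq_monomial, C_mul_monomial, monomial_mul, one_mul, mul_one,
      Finsupp.single_add]
  simp_rw [hterm, coeff_monomial]
  rw [Finset.sum_eq_single e]
  · rw [if_pos (by rw [Nat.add_sub_cancel' he])]
  · intro k hk hke
    rw [if_neg]
    intro h
    have h1 := DFunLike.congr_fun h j
    simp only [Finsupp.single_eq_same] at h1
    have := Finset.mem_range.1 hk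
    omega
  · intro h
    exact absurd (Finset.mem_range.2 (Nat.lt_succ_of_le he)) h

/-- The one-variable kernel involves only its variable. [folklore] -/
private theorem vars_kernel_subset [Nontrivial A] (j : σ) (d : ℕ) (t : ℕ → A) :
    (∑ k ∈ Finset.range (d + 1), C (t k) * X j ^ (d - k) : MvPolynomial σ A).vars ⊆ {j} := by
  refine (vars_sum_subset _ _).trans (Finset.biUnion_subset.2 fun k _ => ?_)
  refine (vars_mul _ _).trans (Finset.union_subset ?_ ?_)
  · rw [vars_C]
    exact Finset.empty_subset _
  · exact (vars_pow _ _).trans (by rw [vars_X])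

/-- **Kernel coefficient formula**: for `M` supported in `J` with `M ≤ d` on `J`, the
`X_J^{(d,…,d)}`-coefficient of `r X^M · ∏_{j ∈ J} Σ_{k ≤ d} t_{j,k} X_j^{d−k}` is `r ∏_{j∈J} t_{j, M_j}`.
[folklore] -/
private theorem coeff_monomial_mul_kernel [Nontrivial A] (t : σ → ℕ → A) (d : ℕ) (J : Finset σ) :
    ∀ (M : σ →₀ ℕ) (r : A), M.support ⊆ J → (∀ j ∈ J, M j ≤ d) →
      coeff (∑ j ∈ J, Finsupp.single j d)
        (monomial M r * ∏ j ∈ J, ∑ k ∈ Finset.range (d + 1), C (t j k) * X j ^ (d - k)) =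
        r * ∏ j ∈ J, t j (M j) := by
  classical
  induction J using Finset.induction_on with
  | empty =>
    intro M r hM _
    have hM0 : M = 0 := Finsupp.support_eq_empty.1 (Finset.subset_empty.1 hM)
    subst hM0
    simp
  | insert j₀ J hj₀ ih =>
    intro M r hM hd
    have hne : ∀ j ∈ J, j ≠ j₀ := fun j hj h => hj₀ (h ▸ hj)
    have hD : (∑ j ∈ J, Finsupp.single j d) j₀ = 0 := by
      rw [Finsupp.finsetSum_apply]
      exact Finset.sum_eq_zero fun j hj => by rw [Finsupp.single_apply, if_neg (hne j hj)]
    have hP : (X j₀ ^ M j₀ * ∑ k ∈ Finset.range (d + 1), C (t j₀ k) * X j₀ ^ (d - k) :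
        MvPolynomial σ A).vars ⊆ {j₀} :=
      (vars_mul _ _).trans (Finset.union_subset ((vars_pow _ _).trans (by rw [vars_X]))
        (vars_kernel_subset j₀ d (t j₀)))
    have hQ : j₀ ∉ (monomial (M.erase j₀) r *
        ∏ j ∈ J, ∑ k ∈ Finset.range (d + 1), C (t j k) * X j ^ (d - k) : MvPolynomial σ A).vars := by
      intro h
      rcases Finset.mem_union.1 (vars_mul _ _ h) with h1 | h2
      · obtain ⟨u, hu, hj⟩ := (mem_vars_iff_mem_support j₀).1 h1
        have hu' : u = M.erase j₀ := Finset.mem_singleton.1 (support_monomial_subset hu)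
        rw [hu', Finsupp.mem_support_iff, Finsupp.erase_same] at hj
        exact hj rfl
      · obtain ⟨j, hj, hj'⟩ := Finset.mem_biUnion.1 (vars_prod _ h2)
        exact hne j hj (Finset.mem_singleton.1 (vars_kernel_subset j d (t j) hj')).symm
    have hsupp : (M.erase j₀).support ⊆ J := by
      intro i hi
      rw [Finsupp.support_erase] at hi
      exact (Finset.mem_insert.1 (hM (Finset.mem_of_mem_erase hi))).resolve_left
        (Finset.ne_of_mem_erase hi)
    have hbd : ∀ j ∈ J, (M.erase j₀) j ≤ d := fun j hj => by
      rw [Finsupp.erase_ne (hne j hj)]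
      exact hd j (Finset.mem_insert_of_mem hj)
    have hsplit : monomial M r = X j₀ ^ (M j₀) * monomial (M.erase j₀) r := by
      rw [X_pow_eq_monomial, monomial_mul, one_mul, Finsupp.single_add_erase]
    rw [Finset.sum_insert hj₀, Finset.prod_insert hj₀, Finset.prod_insert hj₀, hsplit,
      mul_mul_mul_comm, coeff_single_add_mul j₀ d _ hD _ _ hP hQ,
      coeff_X_pow_mul_kernel j₀ (hd j₀ (Finset.mem_insert_self _ _)) (t j₀), ih (M.erase j₀) r hsupp hbd,
      Finset.prod_congr rfl fun j hj => by rw [Finsupp.erase_ne (hne j hj)]]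
    ring

end KernelCoeff

section Words

variable {K : Type*} [Field K] {σ : Type*}

/-- Iterated integration along a word is additive. [cite: Burgisser2024Completeness, §3.1 (p0013 L39–L47)] -/
theorem foldr_dintegral_add (a b : σ → K) (l : List σ) (f g : MvPolynomial σ K) :
    l.foldr (fun j q => dintegral j (a j) (b j) q) (f + g) =
      l.foldr (fun j q => dintegral j (a j) (b j) q) f +
        l.foldr (fun j q => dintegral j (a j) (b j) q) g := by
  induction l with
  | nil => rfl
  | cons j l ih => rw [List.foldr_cons, List.foldr_cons, List.foldr_cons, ih, dintegral_add]

/-- Iterated integration of `0` is `0`. [cite: Burgisser2024Completeness, §3.1 (p0013 L39–L47)] -/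
theorem foldr_dintegral_zero (a b : σ → K) (l : List σ) :
    l.foldr (fun j q => dintegral j (a j) (b j) q) (0 : MvPolynomial σ K) = 0 := by
  induction l with
  | nil => rfl
  | cons j l ih => rw [List.foldr_cons, ih, dintegral_zero]

/-- Iterated integration along a word commutes with finite sums.
[cite: Burgisser2024Completeness, §3.1 (p0013 L39–L47)] -/
theorem foldr_dintegral_sum {ι : Type*} (a b : σ → K) (l : List σ) (s : Finset ι)
    (f : ι → MvPolynomial σ K) :
    l.foldr (fun j q => dintegral j (a j) (b j) q) (∑ i ∈ s, f i) =
      ∑ i ∈ s, l.foldr (fun j q => dintegral j (a j) (b j) q) (f i) := by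
  classical
  induction s using Finset.induction_on with
  | empty => rw [Finset.sum_empty, Finset.sum_empty, foldr_dintegral_zero]
  | insert i s hi ih => rw [Finset.sum_insert hi, Finset.sum_insert hi, foldr_dintegral_add, ih]

/-- Iterated integration along a word commutes with constants.
[cite: Burgisser2024Completeness, §3.1 (p0013 L39–L47)] -/
theorem foldr_dintegral_C_mul (a b : σ → K) (l : List σ) (r : K) (f : MvPolynomial σ K) :
    l.foldr (fun j q => dintegral j (a j) (b j) q) (C r * f) =
      C r * l.foldr (fun j q => dintegral j (a j) (b j) q) f := by
  induction l with
  | nil => rfl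
  | cons j l ih => rw [List.foldr_cons, List.foldr_cons, ih, dintegral_C_mul]

/-- **Iterated integrals of a monomial**: `∫ dX_{v₁} ⋯ ∫ dX_{v_r} (c X^m)` deletes the variables of
the word and multiplies the coefficient by `(b_j^{m_j+1} − a_j^{m_j+1})/(m_j+1)` for the innermost
occurrence of each letter `j` and by `b_j − a_j` for every further occurrence.
[cite: Burgisser2024Completeness, §3.1 (p0013 L39–L47)] -/
theorem foldr_dintegral_monomial [DecidableEq σ] (a b : σ → K) (l : List σ) (m : σ →₀ ℕ) (c : K) :
    l.foldr (fun j q => dintegral j (a j) (b j) q) (monomial m c) =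
      monomial (m.filter fun i => i ∉ l)
        (c * ∏ j ∈ l.toFinset, ((b j - a j) ^ (l.count j - 1) *
          ((b j ^ (m j + 1) - a j ^ (m j + 1)) / ((m j : K) + 1)))) := by
  induction l with
  | nil =>
    have hm : (m.filter fun i => i ∉ ([] : List σ)) = m := by
      ext i
      rw [Finsupp.filter_apply, if_pos List.not_mem_nil]
    rw [List.foldr_nil, List.toFinset_nil, Finset.prod_empty, mul_one, hm]
  | cons j l ih =>
    rw [List.foldr_cons, ih, dintegral_monomial]
    have hfilt : (m.filter fun i => i ∉ l).erase j = m.filter fun i => i ∉ j :: l := by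
      ext i
      by_cases hij : i = j
      · subst hij
        rw [Finsupp.erase_same, Finsupp.filter_apply, if_neg (fun h => h List.mem_cons_self)]
      · rw [Finsupp.erase_ne hij, Finsupp.filter_apply, Finsupp.filter_apply]
        simp only [List.mem_cons, hij, false_or]
    rw [hfilt]
    congr 1
    by_cases hj : j ∈ l
    · -- a repeated letter: the integrand is already free of `X_j`
      have hk : (m.filter fun i => i ∉ l) j = 0 := by
        rw [Finsupp.filter_apply, if_neg (not_not.2 hj)]
      have htf : (j :: l).toFinset = l.toFinset := by
        rw [List.toFinset_cons, Finset.insert_eq_of_mem (List.mem_toFinset.2 hj)]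
      have hjm : j ∈ l.toFinset := List.mem_toFinset.2 hj
      obtain ⟨n, hn⟩ : ∃ n, l.count j = n + 1 :=
        Nat.exists_eq_add_one.2 (List.count_pos_iff.2 hj)
      have hP : ∏ x ∈ l.toFinset, (b x - a x) ^ ((j :: l).count x - 1) *
            ((b x ^ (m x + 1) - a x ^ (m x + 1)) / ((m x : K) + 1)) =
          (b j - a j) * ∏ x ∈ l.toFinset, (b x - a x) ^ (l.count x - 1) *
            ((b x ^ (m x + 1) - a x ^ (m x + 1)) / ((m x : K) + 1)) := by
        rw [← Finset.mul_prod_erase _ _ hjm, ← Finset.mul_prod_erase _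
          (fun x => (b x - a x) ^ (l.count x - 1) *
            ((b x ^ (m x + 1) - a x ^ (m x + 1)) / ((m x : K) + 1))) hjm]
        have hrest : ∏ x ∈ l.toFinset.erase j, (b x - a x) ^ ((j :: l).count x - 1) *
              ((b x ^ (m x + 1) - a x ^ (m x + 1)) / ((m x : K) + 1)) =
            ∏ x ∈ l.toFinset.erase j, (b x - a x) ^ (l.count x - 1) *
              ((b x ^ (m x + 1) - a x ^ (m x + 1)) / ((m x : K) + 1)) :=
          Finset.prod_congr rfl fun x hx => by
            have hxj : j ≠ x := (Finset.ne_of_mem_erase hx).symm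
            simp [hxj]
        rw [hrest, List.count_cons_self, hn]
        simp only [Nat.add_sub_cancel, pow_succ]
        ring
      rw [hk, htf, hP]
      simp only [Nat.cast_zero, zero_add, pow_one, div_one]
      ring
    · -- a new letter
      have hk : (m.filter fun i => i ∉ l) j = m j := by
        rw [Finsupp.filter_apply, if_pos hj]
      have hjt : j ∉ l.toFinset := fun h => hj (List.mem_toFinset.1 h)
      have hrest : ∏ x ∈ l.toFinset, (b x - a x) ^ ((j :: l).count x - 1) *
            ((b x ^ (m x + 1) - a x ^ (m x + 1)) / ((m x : K) + 1)) =
          ∏ x ∈ l.toFinset, (b x - a x) ^ (l.count x - 1) *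
            ((b x ^ (m x + 1) - a x ^ (m x + 1)) / ((m x : K) + 1)) :=
        Finset.prod_congr rfl fun x hx => by
          have hxj : j ≠ x := fun h => hjt (h ▸ hx)
          simp [hxj]
      rw [hk, List.toFinset_cons, Finset.prod_insert hjt, hrest, List.count_cons_self,
        List.count_eq_zero.2 hj]
      simp only [Nat.zero_add, Nat.sub_self, pow_zero, one_mul]
      ring

/-- Reindexing a product over the letters of a duplicate-free word read through an injection.
[folklore] -/
private theorem prod_map_toFinset_eq {α R : Type*} [DecidableEq α] [DecidableEq σ] [CommMonoid R]
    (l : List α) (hl : l.Nodup) (g : α → σ) (hg : Function.Injective g) (u F : σ → R) :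
    ∏ v ∈ (l.map g).toFinset, u v ^ ((l.map g).count v - 1) * F v = ∏ j ∈ l.toFinset, F (g j) := by
  have himage : (l.map g).toFinset = l.toFinset.image g := by
    ext v
    simp [List.mem_toFinset, Finset.mem_image]
  rw [himage, Finset.prod_image fun x _ y _ h => hg h]
  refine Finset.prod_congr rfl fun j hj => ?_
  rw [List.count_eq_one_of_mem (hl.map hg) (List.mem_map_of_mem (List.mem_toFinset.1 hj)),
    Nat.sub_self, pow_zero, one_mul]

/-- **One-shot coefficient formula for iterated integrals.**  Move the letters of the word `l` to
an outer block of variables (`X_i ↦ X_{inl i}` for `i ∈ l`, `X_i ↦ X_{inr i}` otherwise), multiply by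
the kernel `∏_{j ∈ l} (b_j − a_j)^{#_l j − 1} Σ_{k ≤ d} (b_j^{k+1} − a_j^{k+1})/(k+1) · X_{inl j}^{d−k}`,
and take the coefficient of `∏_{j∈l} X_{inl j}^d` (a polynomial in the inner block): this is the
iterated integral, provided `deg_{X_j} f ≤ d` for the letters `j` of `l`.
[cite: Burgisser2024Completeness, §3.1 (p0013 L39–L47)] -/
theorem foldr_dintegral_eq_coeff [DecidableEq σ] (a b : σ → K) (l : List σ) (f : MvPolynomial σ K) {d : ℕ}
    (hd : ∀ j ∈ l, degreeOf j f ≤ d) :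
    l.foldr (fun j q => dintegral j (a j) (b j) q) f =
      coeff (∑ j ∈ l.toFinset, Finsupp.single j d)
        (sumAlgEquiv K σ σ
          (aeval (fun i => if i ∈ l then X (Sum.inl i) else X (Sum.inr i)) f *
            ∏ j ∈ l.toFinset, (C ((b j - a j) ^ (l.count j - 1)) *
              ∑ k ∈ Finset.range (d + 1),
                C ((b j ^ (k + 1) - a j ^ (k + 1)) / ((k : K) + 1)) * X (Sum.inl j) ^ (d - k)))) := by
  classical
  -- the substitution is the renaming along `ψ`
  let ψ : σ → σ ⊕ σ := fun i => if i ∈ l then Sum.inl i else Sum.inr i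
  have haeval : (aeval fun i => if i ∈ l then X (Sum.inl i) else X (Sum.inr i) :
      MvPolynomial σ K →ₐ[K] MvPolynomial (σ ⊕ σ) K) = rename ψ := by
    refine MvPolynomial.algHom_ext fun i => ?_
    rw [aeval_X, rename_X]
    simp only [ψ, apply_ite X]
  -- pull the constants `(b_j − a_j)^{#_l j − 1}` out of the kernel
  have hkernel : (∏ j ∈ l.toFinset, (C ((b j - a j) ^ (l.count j - 1)) *
      ∑ k ∈ Finset.range (d + 1), C ((b j ^ (k + 1) - a j ^ (k + 1)) / ((k : K) + 1)) *
        X (Sum.inl j) ^ (d - k)) : MvPolynomial (σ ⊕ σ) K) =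
      C (∏ j ∈ l.toFinset, (b j - a j) ^ (l.count j - 1)) *
        ∏ j ∈ l.toFinset, ∑ k ∈ Finset.range (d + 1),
          C ((b j ^ (k + 1) - a j ^ (k + 1)) / ((k : K) + 1)) * X (Sum.inl j) ^ (d - k) := by
    rw [map_prod, ← Finset.prod_mul_distrib]
  rw [haeval, hkernel]
  -- reduce to monomials with exponents `≤ d` on `l`
  conv_lhs => rw [f.as_sum]
  conv_rhs => rw [f.as_sum]
  rw [foldr_dintegral_sum, map_sum, Finset.sum_mul, map_sum, coeff_sum]
  refine Finset.sum_congr rfl fun m hm => ?_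
  have hmd : ∀ j ∈ l, m j ≤ d := fun j hj => (monomial_le_degreeOf j hm).trans (hd j hj)
  rw [foldr_dintegral_monomial, rename_monomial, mul_left_comm, ← mul_assoc, C_mul_monomial,
    map_mul (sumAlgEquiv K σ σ), sumAlgEquiv_monomial, map_prod (sumAlgEquiv K σ σ)]
  simp only [map_sum (sumAlgEquiv K σ σ), map_mul (sumAlgEquiv K σ σ), map_pow (sumAlgEquiv K σ σ),
    sumAlgEquiv_X_inl, sumAlgEquiv_C_inl]
  -- the exponent blocks of the renamed monomial
  have hψinj : Function.Injective ψ := by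
    intro x y hxy
    have hxy : (if x ∈ l then Sum.inl x else Sum.inr x : σ ⊕ σ) =
        if y ∈ l then Sum.inl y else Sum.inr y := hxy
    by_cases hx : x ∈ l <;> by_cases hy : y ∈ l
    · rw [if_pos hx, if_pos hy] at hxy; exact Sum.inl_injective hxy
    · rw [if_pos hx, if_neg hy] at hxy; cases hxy
    · rw [if_neg hx, if_pos hy] at hxy; cases hxy
    · rw [if_neg hx, if_neg hy] at hxy; exact Sum.inr_injective hxy
  have h1 : (Finsupp.sumFinsuppAddEquivProdFinsupp (Finsupp.mapDomain ψ m)).1 =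
      m.filter fun i => i ∈ l := by
    ext i
    rw [Finsupp.fst_sumFinsuppAddEquivProdFinsupp, Finsupp.filter_apply]
    by_cases hi : i ∈ l
    · have : ψ i = Sum.inl i := if_pos hi
      rw [if_pos hi, ← this, Finsupp.mapDomain_apply hψinj]
    · rw [if_neg hi, Finsupp.mapDomain_notin_range]
      rintro ⟨x, hx⟩
      have hx : (if x ∈ l then Sum.inl x else Sum.inr x : σ ⊕ σ) = Sum.inl i := hx
      by_cases hx' : x ∈ l
      · rw [if_pos hx'] at hx
        exact hi (Sum.inl_injective hx ▸ hx')
      · rw [if_neg hx'] at hx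
        cases hx
  have h2 : (Finsupp.sumFinsuppAddEquivProdFinsupp (Finsupp.mapDomain ψ m)).2 =
      m.filter fun i => i ∉ l := by
    ext i
    rw [Finsupp.snd_sumFinsuppAddEquivProdFinsupp, Finsupp.filter_apply]
    by_cases hi : i ∈ l
    · rw [if_neg (not_not.2 hi), Finsupp.mapDomain_notin_range]
      rintro ⟨x, hx⟩
      have hx : (if x ∈ l then Sum.inl x else Sum.inr x : σ ⊕ σ) = Sum.inr i := hx
      by_cases hx' : x ∈ l
      · rw [if_pos hx'] at hx
        cases hx
      · rw [if_neg hx'] at hx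
        exact hx' (Sum.inr_injective hx ▸ hi)
    · have : ψ i = Sum.inr i := if_neg hi
      rw [if_pos hi, ← this, Finsupp.mapDomain_apply hψinj]
  rw [h1, h2, coeff_monomial_mul_kernel _ d l.toFinset _ _ ?_ ?_]
  · rw [← map_prod C, mul_comm (monomial _ _) (C _), C_mul_monomial]
    congr 1
    have hW : ∏ j ∈ l.toFinset, (b j ^ ((m.filter fun i => i ∈ l) j + 1) -
          a j ^ ((m.filter fun i => i ∈ l) j + 1)) / (((m.filter fun i => i ∈ l) j : K) + 1) =
        ∏ j ∈ l.toFinset, (b j ^ (m j + 1) - a j ^ (m j + 1)) / ((m j : K) + 1) :=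
      Finset.prod_congr rfl fun j hj => by
        rw [Finsupp.filter_apply, if_pos (List.mem_toFinset.1 hj)]
    rw [hW, Finset.prod_mul_distrib]
    ring
  · intro i hi
    rw [Finsupp.mem_support_iff, Finsupp.filter_apply] at hi
    by_cases h : i ∈ l
    · exact List.mem_toFinset.2 h
    · exact absurd (if_neg h) hi
  · intro j hj
    rw [Finsupp.filter_apply, if_pos (List.mem_toFinset.1 hj)]
    exact hmd j (List.mem_toFinset.1 hj)

end Words

/-! ## §3. `VNP` is closed under integration (Valiant 1982; Bürgisser 2024, §3.1) -/

section Family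

variable {K : Type u} [Field K] {σ : ℕ → Type v} [∀ n, Fintype (σ n)] [∀ n, DecidableEq (σ n)]

/-- `L(X_i^e) ≤ e`. [folklore] -/
private theorem complexity_X_pow_le_self {τ : Type*} (i : τ) (e : ℕ) :
    complexity (X i ^ e : MvPolynomial τ K) ≤ e := by
  induction e with
  | zero => rw [pow_zero, ← C_1, complexity_C_holds]
  | succ e ih =>
    rw [pow_succ]
    refine (complexity_mul_le_holds _ _).trans ?_
    rw [complexity_X_holds]
    omega

/-- Size of the one-variable kernel: `L(Σ_{k ≤ d} c_k X^{d−k}) ≤ (d+1)(d+2)`. [folklore] -/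
private theorem complexity_kernel_le {τ : Type*} (i : τ) (d : ℕ) (w : ℕ → K) :
    complexity (∑ k ∈ Finset.range (d + 1), C (w k) * X i ^ (d - k) : MvPolynomial τ K) ≤
      (d + 1) * (d + 2) := by
  refine (complexity_finset_sum_le _ _).trans ?_
  rw [Finset.card_range]
  have h : ∑ k ∈ Finset.range (d + 1), complexity (C (w k) * X i ^ (d - k) : MvPolynomial τ K) ≤
      ∑ _k ∈ Finset.range (d + 1), (d + 1) := by
    refine Finset.sum_le_sum fun k _ => (complexity_mul_le_holds _ _).trans ?_
    rw [complexity_C_holds]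
    have := complexity_X_pow_le_self (K := K) i (d - k)
    omega
  rw [Finset.sum_const, Finset.card_range, smul_eq_mul] at h
  nlinarith [h]

/-- Degree of the one-variable kernel: `≤ d`. [folklore] -/
private theorem totalDegree_kernel_le {τ : Type*} (i : τ) (d : ℕ) (w : ℕ → K) :
    (∑ k ∈ Finset.range (d + 1), C (w k) * X i ^ (d - k) : MvPolynomial τ K).totalDegree ≤ d := by
  refine (totalDegree_finsetSum _ _).trans (Finset.sup_le fun k _ => ?_)
  refine (totalDegree_mul _ _).trans ?_
  rw [totalDegree_C, zero_add]
  exact (totalDegree_pow _ _).trans (by rw [totalDegree_X]; omega)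

/-- **The integration kernels form a `VP` family.**  For words `l_n` in the variables `σ_n`, limits
`a_n, b_n` and degree bounds `d_n` that are `p`-bounded (here `d_n = deg f_n`), the kernels of
`foldr_dintegral_eq_coeff` have `p`-bounded size and degree. [cite: Burgisser2024Completeness, §3.1 (p0013 L39–L47)] -/
theorem isVPFamily_integrationKernel (hσ : IsPBounded fun n => Fintype.card (σ n)) {d : ℕ → ℕ}
    (hd : IsPBounded d) (a b : ∀ n, σ n → K) (l : ∀ n, List (σ n)) :
    IsVPFamily (σ := fun n => σ n ⊕ σ n) fun n =>
      ∏ j ∈ (l n).toFinset, (C ((b n j - a n j) ^ ((l n).count j - 1)) *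
        ∑ k ∈ Finset.range (d n + 1),
          C ((b n j ^ (k + 1) - a n j ^ (k + 1)) / ((k : K) + 1)) *
            (X (Sum.inl j) : MvPolynomial (σ n ⊕ σ n) K) ^ (d n - k)) := by
  refine ⟨⟨(IsPBounded.mul_holds (IsPBounded.const 2) hσ).mono fun n => by
      rw [Fintype.card_sum]; omega, (IsPBounded.mul_holds hσ hd).mono fun n => ?_⟩,
    (IsPBounded.mul_holds hσ (IsPBounded.add_holds (IsPBounded.mul_holds (IsPBounded.add_holds hd
      (IsPBounded.const 1)) (IsPBounded.add_holds hd (IsPBounded.const 2)))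
      (IsPBounded.const 2))).mono fun n => ?_⟩
  · -- degree `≤ |l_n| · d_n ≤ #σ_n · d_n`
    have h : ∑ j ∈ (l n).toFinset, (C ((b n j - a n j) ^ ((l n).count j - 1)) *
        ∑ k ∈ Finset.range (d n + 1), C ((b n j ^ (k + 1) - a n j ^ (k + 1)) / ((k : K) + 1)) *
          (X (Sum.inl j) : MvPolynomial (σ n ⊕ σ n) K) ^ (d n - k)).totalDegree ≤
        ∑ _j ∈ (l n).toFinset, d n := by
      refine Finset.sum_le_sum fun j _ => (totalDegree_mul _ _).trans ?_
      rw [totalDegree_C, zero_add]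
      exact totalDegree_kernel_le _ _ _
    rw [Finset.sum_const, smul_eq_mul] at h
    exact (totalDegree_finsetProd _ _).trans (h.trans (Nat.mul_le_mul_right _ (Finset.card_le_univ _)))
  · -- size `≤ #σ_n · ((d_n + 1)(d_n + 2) + 2)`
    refine (complexity_finset_prod_le _ _).trans ?_
    have h : ∑ j ∈ (l n).toFinset, complexity (C ((b n j - a n j) ^ ((l n).count j - 1)) *
        ∑ k ∈ Finset.range (d n + 1), C ((b n j ^ (k + 1) - a n j ^ (k + 1)) / ((k : K) + 1)) *
          (X (Sum.inl j) : MvPolynomial (σ n ⊕ σ n) K) ^ (d n - k)) ≤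
        ∑ _j ∈ (l n).toFinset, ((d n + 1) * (d n + 2) + 1) := by
      refine Finset.sum_le_sum fun j _ => (complexity_mul_le_holds _ _).trans ?_
      rw [complexity_C_holds, zero_add]
      exact Nat.add_le_add_right (complexity_kernel_le _ _ _) 1
    rw [Finset.sum_const, smul_eq_mul] at h
    have hc : (l n).toFinset.card ≤ Fintype.card (σ n) := Finset.card_le_univ _
    calc _ ≤ (l n).toFinset.card * ((d n + 1) * (d n + 2) + 1) + (l n).toFinset.card :=
          Nat.add_le_add_right h _
      _ = (l n).toFinset.card * ((d n + 1) * (d n + 2) + 2) := by ring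
      _ ≤ Fintype.card (σ n) * ((d n + 1) * (d n + 2) + 2) := Nat.mul_le_mul_right _ hc

/-- **`VNP` is closed under iterated integration along arbitrary words** (Valiant 1982;
Bürgisser 2024, §3.1: "`VNP` is closed under `p`-bounded applications of … integration"),
characteristic zero: if `(f_n)` is `p`-definable, then so is
`(∫_{a_{n,v₁}}^{b_{n,v₁}} dX_{v₁} ⋯ ∫_{a_{n,v_r}}^{b_{n,v_r}} f_n dX_{v_r})_n` for EVERY choice of words
`l_n = [v₁, …, v_{r(n)}]` of variables and of limits — no bound on `r(n)` is needed (a letter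
already integrated out only contributes the constant factor `b − a`).  Proof: the iterated integral
is one coefficient, with respect to the block of integrated variables, of `f_n` times the `VP`
kernel (`foldr_dintegral_eq_coeff`, `isVPFamily_integrationKernel`); `VNP` is closed under the
block substitution (`IsVNPFamily.aeval`), under products (`IsVNPFamily.mul`) and under taking
coefficients (Prop. 3.1, `IsVNPFamily.coeff_sumAlgEquiv`).
[cite: Burgisser2024Completeness, §3.1 (p0013 L39–L40)] [cite: Valiant1982, §3] -/
theorem IsVNPFamily.foldr_dintegral [CharZero K] {f : ∀ n, MvPolynomial (σ n) K}
    (hf : IsVNPFamily f) (a b : ∀ n, σ n → K) (l : ∀ n, List (σ n)) :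
    IsVNPFamily fun n => (l n).foldr (fun j q => dintegral j (a n j) (b n j) q) (f n) := by
  classical
  have hσ : IsPBounded fun n => Fintype.card (σ n) := hf.1.1
  have hdeg : IsPBounded fun n => (f n).totalDegree := hf.1.2
  -- moving the integrated variables to the outer block keeps `VNP`
  have hτ : IsPBounded fun n => Fintype.card (σ n ⊕ σ n) :=
    (IsPBounded.mul_holds (IsPBounded.const 2) hσ).mono fun n => by rw [Fintype.card_sum]; omega
  have hgd : IsPBounded fun n => Finset.univ.sup fun i : σ n =>
      (if i ∈ l n then (X (Sum.inl i) : MvPolynomial (σ n ⊕ σ n) K) else X (Sum.inr i)).totalDegree :=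
    (IsPBounded.const 1).mono fun n => Finset.sup_le fun i _ => by
      split_ifs <;> exact (totalDegree_X (R := K) _).le
  have hgc : IsPBounded fun n => ∑ i : σ n,
      complexity (if i ∈ l n then (X (Sum.inl i) : MvPolynomial (σ n ⊕ σ n) K) else X (Sum.inr i)) :=
    (IsPBounded.const 0).mono fun n => le_of_eq (Finset.sum_eq_zero fun i _ => by
      split_ifs <;> exact complexity_X_holds _)
  have hsplit : IsVNPFamily (σ := fun n => σ n ⊕ σ n) fun n =>
      MvPolynomial.aeval (fun i => if i ∈ l n then (X (Sum.inl i) : MvPolynomial (σ n ⊕ σ n) K)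
        else X (Sum.inr i)) (f n) :=
    IsVNPFamily.aeval hf (τ := fun n => σ n ⊕ σ n)
      (fun n i => if i ∈ l n then (X (Sum.inl i) : MvPolynomial (σ n ⊕ σ n) K) else X (Sum.inr i))
      hτ hgd hgc
  have hprod := IsVNPFamily.mul hsplit (IsVPFamily.isVNPFamily_holds'
    (isVPFamily_integrationKernel hσ hdeg a b l))
  have hcoeff := IsVNPFamily.coeff_sumAlgEquiv (ρ := σ) (τ := σ) hprod
    fun n => ∑ j ∈ (l n).toFinset, Finsupp.single j (f n).totalDegree
  refine (iff_of_eq (congrArg IsVNPFamily (funext fun n => ?_))).2 hcoeff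
  exact foldr_dintegral_eq_coeff (a n) (b n) (l n) (f n) fun j _ => degreeOf_le_totalDegree (f n) j

/-- **`VNP` is closed under integration** (one integral per index): if `(f_n)` is `p`-definable
then so is `(∫_{a_n}^{b_n} f_n dX_{j_n})_n`. [cite: Burgisser2024Completeness, §3.1 (p0013 L39–L40)] [cite: Valiant1982, §3] -/
theorem isVNPFamily_dintegral [CharZero K] {f : ∀ n, MvPolynomial (σ n) K} (hf : IsVNPFamily f)
    (j : ∀ n, σ n) (a b : ℕ → K) :
    IsVNPFamily fun n => dintegral (j n) (a n) (b n) (f n) :=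
  IsVNPFamily.foldr_dintegral hf (fun n _ => a n) (fun n _ => b n) fun n => [j n]

end Family

/-! ## §4. The survey's displayed identity: `(3/2)ⁿ ∫_{-1}^{1} ⋯ ∫_{-1}^{1} y₁ ⋯ yₙ f_n dy = PER_n` -/

section PermanentIntegral

variable {K : Type u} [Field K] {ι : Type v} [Fintype ι] [DecidableEq ι] {τ : Type w} [Fintype τ]
  [DecidableEq τ]

/-- A product of distinct-indexed variables is a monomial. [folklore] -/
private theorem prod_X_eq_monomial {α : Type*} {σ' : Type*} {R : Type*} [CommSemiring R]
    [DecidableEq α] (s : Finset α) (g : α → σ') :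
    (∏ j ∈ s, X (g j) : MvPolynomial σ' R) = monomial (∑ j ∈ s, Finsupp.single (g j) 1) 1 := by
  induction s using Finset.induction_on with
  | empty => simp
  | insert a s ha ih =>
    have hX : (X (g a) : MvPolynomial σ' R) = monomial (Finsupp.single (g a) 1) 1 := rfl
    rw [Finset.prod_insert ha, Finset.sum_insert ha, ih, hX, monomial_mul, one_mul]

omit [DecidableEq ι] [DecidableEq τ] in
/-- The weight "degree in the `y`-block". [folklore] -/
private theorem weight_sumElim_one_zero (M : ι ⊕ τ →₀ ℕ) :
    Finsupp.weight (Sum.elim (fun _ : ι => (1 : ℕ)) (fun _ : τ => 0)) M = ∑ j, M (Sum.inl j) := by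
  rw [Finsupp.weight_apply, Finsupp.sum_fintype _ _ (fun _ => by simp), Fintype.sum_sum_type]
  simp

/-- **Iterated integral over the cube `[-1,1]^ι` against `y₁ ⋯ yₙ` extracts the multilinear part.**
For `p ∈ K[y ⊔ x]` homogeneous of degree `n = #ι` in the `y`-block (weights `1` on `y`, `0` on
`x`), `∫_{-1}^{1} ⋯ ∫_{-1}^{1} y₁ ⋯ yₙ · p dy₁ ⋯ dyₙ = (2/3)ⁿ · [y₁ ⋯ yₙ] p`: a monomial
`y^{𝟙 + e} x^β` of `y₁⋯yₙ p` integrates to `∏_j (1 − (−1)^{e_j + 2})/(e_j + 2) · x^β`, which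
vanishes unless every `e_j` is odd, i.e. (as `Σ e_j = n`) unless `e = 𝟙`, where it is `(2/3)ⁿ x^β`.
[cite: Burgisser2024Completeness, §3.1 (p0013 L43–L47)] -/
theorem foldr_dintegral_prod_X_mul_of_isWeightedHomogeneous [CharZero K] (l : List ι) (hl : l.Nodup)
    (hall : ∀ j, j ∈ l) (p : MvPolynomial (ι ⊕ τ) K)
    (hp : IsWeightedHomogeneous (Sum.elim (fun _ : ι => (1 : ℕ)) (fun _ : τ => 0)) p
      (Fintype.card ι)) :
    l.foldr (fun j q => dintegral (Sum.inl j) (-1) 1 q) ((∏ j, X (Sum.inl j)) * p) =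
      C ((2 / 3 : K) ^ Fintype.card ι) *
        rename Sum.inr (coeff (∑ j, Finsupp.single j 1) (sumAlgEquiv K ι τ p)) := by
  classical
  have huniv : l.toFinset = Finset.univ :=
    Finset.eq_univ_iff_forall.2 fun j => List.mem_toFinset.2 (hall j)
  -- the word `l` read in `ι ⊕ τ`
  have hfold : ∀ q : MvPolynomial (ι ⊕ τ) K, l.foldr (fun j q => dintegral (Sum.inl j) (-1) 1 q) q =
      (l.map Sum.inl).foldr (fun v q => dintegral v ((fun _ => (-1 : K)) v) ((fun _ => (1 : K)) v) q)
        q := by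
    intro q
    rw [List.foldr_map]
  -- the exponent `𝟙 = Σ_j e_{y_j}` of `y₁ ⋯ yₙ`
  have hone_inl : ∀ j : ι, (∑ j' : ι, Finsupp.single (Sum.inl j') 1 : ι ⊕ τ →₀ ℕ) (Sum.inl j) = 1 :=
    fun j => by simp [Finsupp.finsetSum_apply, Finsupp.single_apply]
  have hone_inr : ∀ t : τ, (∑ j' : ι, Finsupp.single (Sum.inl j') 1 : ι ⊕ τ →₀ ℕ) (Sum.inr t) = 0 :=
    fun t => by simp [Finsupp.finsetSum_apply]
  -- expand `p` into monomials
  conv_lhs => rw [p.as_sum, Finset.mul_sum]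
  conv_rhs => rw [p.as_sum]
  rw [hfold, foldr_dintegral_sum, map_sum, coeff_sum, map_sum, Finset.mul_sum]
  refine Finset.sum_congr rfl fun M hM => ?_
  have hwt : ∑ j, M (Sum.inl j) = Fintype.card ι := by
    rw [← weight_sumElim_one_zero]
    exact hp (mem_support_iff.1 hM)
  rw [prod_X_eq_monomial, monomial_mul, one_mul, foldr_dintegral_monomial, sumAlgEquiv_monomial,
    coeff_monomial]
  -- the integration weights, indexed by `ι`
  rw [prod_map_toFinset_eq l hl Sum.inl Sum.inl_injective, huniv]
  have hprod : ∏ j : ι, ((1 : K) ^ ((∑ j' : ι, Finsupp.single (Sum.inl j') 1 + M : ι ⊕ τ →₀ ℕ)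
        (Sum.inl j) + 1) -
        (-1 : K) ^ ((∑ j' : ι, Finsupp.single (Sum.inl j') 1 + M : ι ⊕ τ →₀ ℕ) (Sum.inl j) + 1)) /
          ((((∑ j' : ι, Finsupp.single (Sum.inl j') 1 + M : ι ⊕ τ →₀ ℕ) (Sum.inl j) : ℕ) : K) + 1) =
      ∏ j : ι, (1 - (-1 : K) ^ M (Sum.inl j)) / ((M (Sum.inl j) : K) + 2) := by
    refine Finset.prod_congr rfl fun j _ => ?_
    rw [Finsupp.add_apply, hone_inl]
    simp only [one_pow, Nat.cast_add, Nat.cast_one]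
    rw [show 1 + M (Sum.inl j) + 1 = M (Sum.inl j) + 2 by ring, pow_add, neg_one_sq, mul_one]
    ring
  rw [hprod]
  by_cases hall1 : ∀ j, M (Sum.inl j) = 1
  · -- the multilinear monomials `y₁ ⋯ yₙ x^β`
    have hM1 : (Finsupp.sumFinsuppAddEquivProdFinsupp M).1 = ∑ j, Finsupp.single j 1 := by
      ext j
      rw [Finsupp.fst_sumFinsuppAddEquivProdFinsupp, hall1]
      simp [Finsupp.finsetSum_apply, Finsupp.single_apply]
    rw [if_pos hM1, rename_monomial, C_mul_monomial]
    refine (monomial_eq_monomial_iff _ _ _ _).2 (Or.inl ⟨?_, ?_⟩)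
    · -- the surviving exponent is the `x`-part of `M`
      ext v
      rcases v with j | t
      · rw [Finsupp.filter_apply, if_neg (not_not.2 (List.mem_map.2 ⟨j, hall j, rfl⟩)),
          Finsupp.mapDomain_notin_range]
        rintro ⟨t, ht⟩
        cases ht
      · rw [Finsupp.filter_apply, if_pos, Finsupp.add_apply, hone_inr, zero_add,
          Finsupp.mapDomain_apply Sum.inr_injective, Finsupp.snd_sumFinsuppAddEquivProdFinsupp]
        intro h
        obtain ⟨j, _, hj⟩ := List.mem_map.1 h
        cases hj
    · rw [Finset.prod_congr rfl fun j _ => by rw [hall1 j], Finset.prod_const, Finset.card_univ]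
      norm_num
      ring
  · -- all other monomials integrate to zero and have no `y₁ ⋯ yₙ`-coefficient
    have hM1 : (Finsupp.sumFinsuppAddEquivProdFinsupp M).1 ≠ ∑ j, Finsupp.single j 1 := by
      intro h
      apply hall1
      intro j
      have := DFunLike.congr_fun h j
      rw [Finsupp.fst_sumFinsuppAddEquivProdFinsupp] at this
      rw [this]
      simp [Finsupp.finsetSum_apply, Finsupp.single_apply]
    rw [if_neg hM1, map_zero, mul_zero]
    -- some `y`-exponent of `M` is even
    obtain ⟨j₀, hj₀⟩ : ∃ j, Even (M (Sum.inl j)) := by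
      by_contra h
      have hge : ∀ j, 1 ≤ M (Sum.inl j) := fun j => Nat.one_le_iff_ne_zero.2 fun h0 =>
        h ⟨j, h0 ▸ ⟨0, rfl⟩⟩
      apply hall1
      have heq : ∑ j, M (Sum.inl j) = ∑ _j : ι, 1 := by rw [hwt, Finset.sum_const, smul_eq_mul,
        mul_one, Finset.card_univ]
      intro j
      exact ((Finset.sum_eq_sum_iff_of_le fun j _ => hge j).1 heq.symm j (Finset.mem_univ j)).symm
    rw [Finset.prod_eq_zero (Finset.mem_univ j₀) (by rw [hj₀.neg_one_pow, sub_self, zero_div]),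
      mul_zero, monomial_zero]

omit [DecidableEq ι] in
/-- `f_n = ∏_i Σ_j x_{ij} y_j` is homogeneous of degree `n` in the `y`-block. [folklore] -/
private theorem isWeightedHomogeneous_prod_sum_X_mul_X :
    IsWeightedHomogeneous (Sum.elim (fun _ : ι => (1 : ℕ)) (fun _ : ι × ι => 0))
      (∏ i : ι, ∑ j : ι, X (Sum.inr (i, j)) * X (Sum.inl j) : MvPolynomial (ι ⊕ ι × ι) K)
      (Fintype.card ι) := by
  have h : IsWeightedHomogeneous (Sum.elim (fun _ : ι => (1 : ℕ)) (fun _ : ι × ι => 0))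
      (∏ i : ι, ∑ j : ι, X (Sum.inr (i, j)) * X (Sum.inl j) : MvPolynomial (ι ⊕ ι × ι) K)
      (∑ _i : ι, (0 + 1)) :=
    IsWeightedHomogeneous.prod _ _ _ fun i _ => IsWeightedHomogeneous.sum _ _ _ fun j _ =>
      (isWeightedHomogeneous_X K _ (Sum.inr (i, j))).mul (isWeightedHomogeneous_X K _ (Sum.inl j))
  simpa using h

/-- **Bürgisser 2024, §3.1, the displayed integral identity:
`(3/2)ⁿ ∫_{-1}^{1} ⋯ ∫_{-1}^{1} y₁ ⋯ yₙ f_n dy₁ ⋯ dyₙ = PER_n`** for `f_n = ∏_i (Σ_j x_{ij} y_j)` — the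
formula by which the survey shows that `VF`, `VBP`, `VP` are not closed under `p`-bounded
integration unless they contain `VNP` (the permanent being `VNP`-complete), companion of the
derivative form `∂/∂y₁ ⋯ ∂/∂yₙ f_n = PER_n` (`foldr_pderiv_prod_sum_X_mul_X_eq_perPoly`).  The
integrals `∫_{-1}^{1} dy_j` (`dintegral`) are taken along any duplicate-free list `l` exhausting the
`y`-variables; the result is `PER_n` in the variables `x_{ij}` (the second block); characteristic
`0`.  Proof: `∫ y₁⋯yₙ f_n = (2/3)ⁿ [y₁⋯yₙ] f_n` (`foldr_dintegral_prod_X_mul_of_isWeightedHomogeneous`)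
and `[y₁⋯yₙ] f_n = PER_n` (`coeff_prod_sum_X_mul_X_eq_perPoly`).
[cite: Burgisser2024Completeness, §3.1 (p0013 L43–L47)] -/
theorem Bur24_sec3_1_integral_prod_sum_X_mul_X_eq_perPoly [CharZero K] (l : List ι) (hl : l.Nodup)
    (hall : ∀ j, j ∈ l) :
    C ((3 / 2 : K) ^ Fintype.card ι) *
        l.foldr (fun j q => dintegral (Sum.inl j) (-1) 1 q)
          ((∏ j, X (Sum.inl j)) * ∏ i : ι, ∑ j : ι, X (Sum.inr (i, j)) * X (Sum.inl j) :
            MvPolynomial (ι ⊕ ι × ι) K) =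
      rename Sum.inr (perPoly ι K) := by
  rw [foldr_dintegral_prod_X_mul_of_isWeightedHomogeneous l hl hall _
      isWeightedHomogeneous_prod_sum_X_mul_X, coeff_prod_sum_X_mul_X_eq_perPoly, ← mul_assoc,
    ← map_mul, ← mul_pow]
  norm_num

/-- The same identity along the canonical word `[0, 1, …, n−1]` of `y`-variables (`ι = Fin n`).
[cite: Burgisser2024Completeness, §3.1 (p0013 L43–L47)] -/
theorem Bur24_sec3_1_integral_finRange_prod_sum_X_mul_X_eq_perPoly [CharZero K] (n : ℕ) :
    C ((3 / 2 : K) ^ n) *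
        (List.finRange n).foldr (fun j q => dintegral (Sum.inl j) (-1) 1 q)
          ((∏ j, X (Sum.inl j)) * ∏ i : Fin n, ∑ j : Fin n, X (Sum.inr (i, j)) * X (Sum.inl j) :
            MvPolynomial (Fin n ⊕ Fin n × Fin n) K) =
      rename Sum.inr (perPoly (Fin n) K) := by
  have h := Bur24_sec3_1_integral_prod_sum_X_mul_X_eq_perPoly (K := K) (List.finRange n)
    (List.nodup_finRange n) (List.mem_finRange)
  rwa [Fintype.card_fin] at h

end PermanentIntegral

/-! ## §5. `VF`, `VBP`, `VP` are not closed under integration unless they contain `VNP` -/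

section IntegralClasses

variable (F : Type u) [Field F]

/-- `PER_n` in the variables `x_{ij}` is a (p-)projection of its copy in the variables `y ⊔ x`
(the `x`-block renamed into `y ⊔ x`; substitute `y := 0`). [cite: Burgisser2024Completeness, §3.1 (p0013 L39–L47)] -/
private theorem isPProjection_perPoly_rename_inr' :
    IsPProjection (fun n => perPoly (Fin n) F)
      (fun n => rename (Sum.inr : Fin n × Fin n → Fin n ⊕ Fin n × Fin n) (perPoly (Fin n) F)) := by
  refine ⟨fun n => n, ⟨1, fun n => by rw [pow_one]; exact Nat.le_succ n⟩, fun n => ?_⟩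
  refine ⟨Sum.elim (fun _ => C 0) X, fun i => ?_, ?_⟩
  · cases i with
    | inl j => exact Or.inr ⟨0, rfl⟩
    | inr q => exact Or.inl ⟨q, rfl⟩
  · rw [aeval_rename, Sum.elim_comp_inr, aeval_X_left_apply]

/-- The family `(y₁ ⋯ yₙ)_n` (in the variables `y ⊔ x`) is in `VP`. [folklore] -/
private theorem isVPFamily_prod_X_inl :
    IsVPFamily fun n => (∏ j : Fin n, X (Sum.inl j) : MvPolynomial (Fin n ⊕ Fin n × Fin n) F) := by
  refine ⟨⟨(IsPBounded.add_holds IsPBounded.id (IsPBounded.mul_holds IsPBounded.id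
      IsPBounded.id)).mono fun n => by simp, IsPBounded.id.mono fun n => ?_⟩,
    IsPBounded.id.mono fun n => ?_⟩
  · refine (totalDegree_finsetProd _ _).trans ?_
    simp [totalDegree_X]
  · refine (complexity_finset_prod_le _ _).trans ?_
    rw [Finset.sum_eq_zero fun i _ => complexity_X_holds _]
    simp

/-- `E(∏_{j ∈ s} X_{g j}) ≤ #s`. [folklore] -/
private theorem formulaComplexity_prod_X_le {α τ : Type*} [DecidableEq α] (s : Finset α)
    (g : α → τ) : formulaComplexity (∏ j ∈ s, X (g j) : MvPolynomial τ F) ≤ s.card := by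
  induction s using Finset.induction_on with
  | empty =>
    rw [Finset.prod_empty, Finset.card_empty, ← C_1]
    exact (exists_wexpr_iff_formulaComplexity_le _ 0).mp ⟨.const 1, WExpr.eval_const 1, le_rfl⟩
  | insert a s ha ih =>
    rw [Finset.prod_insert ha, Finset.card_insert_of_notMem ha]
    refine (formulaComplexity_mul_le _ _).trans ?_
    have hX : formulaComplexity (X (g a) : MvPolynomial τ F) ≤ 0 :=
      (exists_wexpr_iff_formulaComplexity_le _ 0).mp ⟨.var (g a), WExpr.eval_var (g a), le_rfl⟩
    omega

/-- The test family `g_n = (3/2)ⁿ · y₁ ⋯ yₙ · f_n` has p-bounded expression size (hence lies in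
`VF ⊆ VBP ⊆ VP`). [cite: Burgisser2024Completeness, §3.1 (p0013 L28–L47)] -/
private theorem isPBounded_formulaComplexity_testFamily :
    IsPBounded fun k => formulaComplexity (C ((3 / 2 : F) ^ k) * ((∏ j : Fin k, X (Sum.inl j)) *
      ∏ i : Fin k, ∑ j : Fin k, X (Sum.inr (i, j)) * X (Sum.inl j)) :
        MvPolynomial (Fin k ⊕ Fin k × Fin k) F) := by
  refine (IsPBounded.add_holds (IsPBounded.add_holds IsPBounded.id
    (isPBounded_formulaComplexity_prod_sum_X_mul_X F)) (IsPBounded.const 2)).mono fun k => ?_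
  refine (formulaComplexity_mul_le _ _).trans ?_
  have hC : formulaComplexity (C ((3 / 2 : F) ^ k) : MvPolynomial (Fin k ⊕ Fin k × Fin k) F) ≤ 0 :=
    (exists_wexpr_iff_formulaComplexity_le _ 0).mp ⟨.const _, WExpr.eval_const _, le_rfl⟩
  have hY := formulaComplexity_prod_X_le F (Finset.univ : Finset (Fin k))
    (Sum.inl : Fin k → Fin k ⊕ Fin k × Fin k)
  rw [Finset.card_univ, Fintype.card_fin] at hY
  have hm := formulaComplexity_mul_le (∏ j : Fin k, X (Sum.inl j) : MvPolynomial (Fin k ⊕ Fin k × Fin k) F)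
    (∏ i : Fin k, ∑ j : Fin k, X (Sum.inr (i, j)) * X (Sum.inl j))
  simp only [id]
  omega

/-- Iterated integration over the `y`-variables commutes with constants. [folklore] -/
private theorem foldr_dintegral_inl_C_mul {ι τ : Type*} {K : Type*} [Field K] (l : List ι) (a b r : K)
    (f : MvPolynomial (ι ⊕ τ) K) :
    l.foldr (fun j q => dintegral (Sum.inl j) a b q) (C r * f) =
      C r * l.foldr (fun j q => dintegral (Sum.inl j) a b q) f := by
  induction l with
  | nil => rfl
  | cons j l ih => rw [List.foldr_cons, List.foldr_cons, ih, dintegral_C_mul]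

variable [CharZero F]

/-- The iterated integral of the test family IS `PER_n` (read in the variables `y ⊔ x`).
[cite: Burgisser2024Completeness, §3.1 (p0013 L43–L47)] -/
private theorem foldr_dintegral_testFamily_eq_perPoly (k : ℕ) :
    (List.finRange k).foldr (fun j q => dintegral (Sum.inl j) (-1) 1 q)
        (C ((3 / 2 : F) ^ k) * ((∏ j : Fin k, X (Sum.inl j)) *
          ∏ i : Fin k, ∑ j : Fin k, X (Sum.inr (i, j)) * X (Sum.inl j)) :
            MvPolynomial (Fin k ⊕ Fin k × Fin k) F) =
      rename Sum.inr (perPoly (Fin k) F) := by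
  rw [foldr_dintegral_inl_C_mul, Bur24_sec3_1_integral_finRange_prod_sum_X_mul_X_eq_perPoly]

/-- **If `VP` is closed under (p-boundedly many) definite integrations, then `(PER_n) ∈ VP`**
(Bürgisser 2024, §3.1: "the classes `VF`, `VBP`, and `VP` fail to be closed under these operations,
as the following formula shows: `… = (3/2)ⁿ ∫_{-1}^{1} ⋯ ∫_{-1}^{1} y₁ ⋯ yₙ f_n dy₁ ⋯ dyₙ = PER_n`").
The hypothesis asks only for closure under integrating `∫_{-1}^{1} dy_j` once along each variable of
a duplicate-free list of distinguished variables; it is applied to the `VF` family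
`((3/2)ⁿ y₁ ⋯ yₙ f_n)_n`, whose iterated integral is `PER_n`. Characteristic `0`.
[cite: Burgisser2024Completeness, §3.1 (p0013 L39–L47)] -/
theorem isVPFamily_perPoly_of_dintegral_closed
    (hVP : ∀ (a : ℕ → ℕ) (τ : ℕ → Type) [∀ k, Fintype (τ k)] [∀ k, DecidableEq (τ k)]
      (f : ∀ k, MvPolynomial (Fin (a k) ⊕ τ k) F) (l : ∀ k, List (Fin (a k))),
      (∀ k, (l k).Nodup) → IsVPFamily f →
      IsVPFamily fun k => (l k).foldr (fun j p => dintegral (Sum.inl j) (-1) 1 p) (f k)) :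
    IsVPFamily fun n => perPoly (Fin n) F := by
  have h := hVP (fun k => k) (fun k => Fin k × Fin k)
    (fun k => C ((3 / 2 : F) ^ k) * ((∏ j : Fin k, X (Sum.inl j)) *
      ∏ i : Fin k, ∑ j : Fin k, X (Sum.inr (i, j)) * X (Sum.inl j)))
    (fun k => List.finRange k) (fun k => List.nodup_finRange k)
    (((isVPFamily_prod_X_inl F).mul (isVPFamily_prod_sum_X_mul_X F)).C_mul fun k => (3 / 2 : F) ^ k)
  simp only [foldr_dintegral_testFamily_eq_perPoly] at h
  exact IsVPFamily.of_isPProjection_holds (isVNPFamily_perPoly_holds F).1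
    (isPProjection_perPoly_rename_inr' F) h

/-- **If `VBP` is closed under (p-boundedly many) definite integrations, then `(PER_n) ∈ VBP`**
(Bürgisser 2024, §3.1; `VBP` = the tree's weakly-skew class `IsVPwsFamily`, survey Def. 2.9).
Characteristic `0`. [cite: Burgisser2024Completeness, §3.1 (p0013 L39–L47) and Def. 2.9 (p0006)] -/
theorem isVPwsFamily_perPoly_of_dintegral_closed
    (hVBP : ∀ (a : ℕ → ℕ) (τ : ℕ → Type) [∀ k, Fintype (τ k)] [∀ k, DecidableEq (τ k)]
      (f : ∀ k, MvPolynomial (Fin (a k) ⊕ τ k) F) (l : ∀ k, List (Fin (a k))),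
      (∀ k, (l k).Nodup) → IsVPwsFamily f →
      IsVPwsFamily fun k => (l k).foldr (fun j p => dintegral (Sum.inl j) (-1) 1 p) (f k)) :
    IsVPwsFamily fun n => perPoly (Fin n) F := by
  have h := hVBP (fun k => k) (fun k => Fin k × Fin k)
    (fun k => C ((3 / 2 : F) ^ k) * ((∏ j : Fin k, X (Sum.inl j)) *
      ∏ i : Fin k, ∑ j : Fin k, X (Sum.inr (i, j)) * X (Sum.inl j)))
    (fun k => List.finRange k) (fun k => List.nodup_finRange k)
    (IsVPwsFamily.of_isPBounded_formulaComplexity (isPBounded_formulaComplexity_testFamily F))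
  simp only [foldr_dintegral_testFamily_eq_perPoly] at h
  exact IsVPwsFamily.of_isPProjection h (isPProjection_perPoly_rename_inr' F)

/-- **If `VF` is closed under (p-boundedly many) definite integrations, then `(PER_n) ∈ VF`**, i.e.
`n ↦ E(PER_n)` is p-bounded (Bürgisser 2024, §3.1; `VF = VP_e`). Characteristic `0`.
[cite: Burgisser2024Completeness, §3.1 (p0013 L39–L47) and Rem. 2.10(3) (p0006)] -/
theorem isPBounded_formulaComplexity_perPoly_of_dintegral_closed
    (hVF : ∀ (a : ℕ → ℕ) (τ : ℕ → Type) [∀ k, Fintype (τ k)] [∀ k, DecidableEq (τ k)]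
      (f : ∀ k, MvPolynomial (Fin (a k) ⊕ τ k) F) (l : ∀ k, List (Fin (a k))),
      (∀ k, (l k).Nodup) → (IsPBounded fun k => formulaComplexity (f k)) →
      IsPBounded fun k => formulaComplexity
        ((l k).foldr (fun j p => dintegral (Sum.inl j) (-1) 1 p) (f k))) :
    IsPBounded fun n => formulaComplexity (perPoly (Fin n) F) := by
  have h := hVF (fun k => k) (fun k => Fin k × Fin k)
    (fun k => C ((3 / 2 : F) ^ k) * ((∏ j : Fin k, X (Sum.inl j)) *
      ∏ i : Fin k, ∑ j : Fin k, X (Sum.inr (i, j)) * X (Sum.inl j)))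
    (fun k => List.finRange k) (fun k => List.nodup_finRange k)
    (isPBounded_formulaComplexity_testFamily F)
  simp only [foldr_dintegral_testFamily_eq_perPoly] at h
  exact isPBounded_formulaComplexity_of_isPProjection h (isPProjection_perPoly_rename_inr' F)

variable {F}

/-- **`VP` is not closed under p-bounded integration unless `VP = VNP`** (Bürgisser 2024, §3.1),
characteristic `0`, as the contrapositive implication: closure of `VP` under the integrations of
`isVPFamily_perPoly_of_dintegral_closed` puts every p-definable family in `VP` (`VNP`-completeness
of the permanent, `isVNPComplete_perPoly_holds`). [cite: Burgisser2024Completeness, §3.1 (p0013 L39–L47)] -/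
theorem IsVNPFamily.isVPFamily_of_dintegral_closed
    (hVP : ∀ (a : ℕ → ℕ) (τ : ℕ → Type) [∀ k, Fintype (τ k)] [∀ k, DecidableEq (τ k)]
      (f : ∀ k, MvPolynomial (Fin (a k) ⊕ τ k) F) (l : ∀ k, List (Fin (a k))),
      (∀ k, (l k).Nodup) → IsVPFamily f →
      IsVPFamily fun k => (l k).foldr
        (fun j p => AlgebraicComplexity.dintegral (Sum.inl j) (-1) 1 p) (f k))
    {v : ℕ → ℕ} {g : ∀ n, MvPolynomial (Fin (v n)) F} (hg : IsVNPFamily g) : IsVPFamily g :=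
  have h2 : ringChar F ≠ 2 := by rw [ringChar.eq F 0]; decide
  IsVPFamily.of_isPProjection_holds hg.1 ((isVNPComplete_perPoly_holds F h2).2 v g hg)
    (isVPFamily_perPoly_of_dintegral_closed F hVP)

/-- **`VBP` is not closed under p-bounded integration unless `VBP ⊇ VNP`** (Bürgisser 2024, §3.1),
characteristic `0`. [cite: Burgisser2024Completeness, §3.1 (p0013 L39–L47) and Def. 2.9 (p0006)] -/
theorem IsVNPFamily.isVPwsFamily_of_dintegral_closed
    (hVBP : ∀ (a : ℕ → ℕ) (τ : ℕ → Type) [∀ k, Fintype (τ k)] [∀ k, DecidableEq (τ k)]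
      (f : ∀ k, MvPolynomial (Fin (a k) ⊕ τ k) F) (l : ∀ k, List (Fin (a k))),
      (∀ k, (l k).Nodup) → IsVPwsFamily f →
      IsVPwsFamily fun k => (l k).foldr
        (fun j p => AlgebraicComplexity.dintegral (Sum.inl j) (-1) 1 p) (f k))
    {v : ℕ → ℕ} {g : ∀ n, MvPolynomial (Fin (v n)) F} (hg : IsVNPFamily g) : IsVPwsFamily g :=
  have h2 : ringChar F ≠ 2 := by rw [ringChar.eq F 0]; decide
  IsVPwsFamily.of_isPProjection (isVPwsFamily_perPoly_of_dintegral_closed F hVBP)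
    ((isVNPComplete_perPoly_holds F h2).2 v g hg)

/-- **`VF` is not closed under p-bounded integration unless `VF ⊇ VNP`** (Bürgisser 2024, §3.1),
characteristic `0`. [cite: Burgisser2024Completeness, §3.1 (p0013 L39–L47) and Rem. 2.10(3) (p0006)] -/
theorem IsVNPFamily.isPBounded_formulaComplexity_of_dintegral_closed
    (hVF : ∀ (a : ℕ → ℕ) (τ : ℕ → Type) [∀ k, Fintype (τ k)] [∀ k, DecidableEq (τ k)]
      (f : ∀ k, MvPolynomial (Fin (a k) ⊕ τ k) F) (l : ∀ k, List (Fin (a k))),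
      (∀ k, (l k).Nodup) → (IsPBounded fun k => formulaComplexity (f k)) →
      IsPBounded fun k => formulaComplexity
        ((l k).foldr (fun j p => AlgebraicComplexity.dintegral (Sum.inl j) (-1) 1 p) (f k)))
    {v : ℕ → ℕ} {g : ∀ n, MvPolynomial (Fin (v n)) F} (hg : IsVNPFamily g) :
    IsPBounded fun n => formulaComplexity (g n) :=
  have h2 : ringChar F ≠ 2 := by rw [ringChar.eq F 0]; decide
  isPBounded_formulaComplexity_of_isPProjection
    (isPBounded_formulaComplexity_perPoly_of_dintegral_closed F hVF)
    ((isVNPComplete_perPoly_holds F h2).2 v g hg)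

end IntegralClasses

end Literature.Computability.AlgebraicComplexity
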